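import Literature.Geometry.Lorentzian.WeightedNorms
import Literature.Geometry.Lorentzian.KerrData
import Mathlib.MeasureTheory.Measure.Lebesgue.EqHaar
import HarnessLib

/-!
# Crux `PhaseMixingCapture.CaptureSufficesC2` (stmt-FinalStateConjecture-14986), line `Sketch`,
# stub `stub_softShieldedScri` — support file 1: LOCALISATION of the weighted Sobolev seminorms

The leaf datum `D_S` of the soft-shield argument agrees with the Kerr–Schild leaf datum
`Kerr.data M a M` identically on the open far region `{r > 4M}` of the slice `{r > M}`, and with
the pulled-back shield datum `φ^* D` on the open collar `{M < r < 4M}`; its distance to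
`Kerr.data` in `H^s_δ × H^{s-1}_{δ+1}` OF THE SLICE is therefore at most the sum of the two
COLLAR seminorms of clauses (i)/(iii) of `IsSoftKerrShieldedC2`, the sphere `{r = 4M}` being
Lebesgue-null.  This file proves the abstract measure-theoretic statements behind this step, for
the restricted weighted Sobolev scale of `Literature/Geometry/Lorentzian/WeightedNorms.lean`
(whose seminorms are set integrals of the junk-extended global `iteratedFDeriv`):

* `iteratedFDeriv_eq_zero_of_eqOn_zero`, `iteratedFDeriv_congr_of_eqOn` — locality of the global
  iterated derivative on open sets;
* `setLIntegral_le_of_eqOn_zero` — if an `ℝ≥0∞`-valued integrand vanishes on a measurable `W` and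
  `U ∖ (V ∪ W)` is null, then `∫⁻_U ≤ ∫⁻_V`;
* `weightedSobolevSeminorm_le_of_eqOn_zero` / `…_eq_of_eqOn_zero` — `‖f‖_{H^s_δ(U)} ≤ ‖f‖_{H^s_δ(V)}`
  (with equality if `V ⊆ U`) whenever `f` vanishes on an open measurable `W` with `U ∖ (V ∪ W)`
  null;
* `weightedSobolevSeminorm_congr` — the seminorm over an OPEN measurable `V` only depends on
  `f|_V`;
* `volume_setOf_radius_eq` — the level sets `{r(0, y) = R}`, `R > 0`, of the Kerr–Schild radius
  are Lebesgue-null (they lie on the confocal ellipsoid `(x² + y²)/(R² + a²) + z²/R² = 1`, a linear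
  image of the unit sphere);
* `dataWeightedSobolevEDist_le_of_eqOn` — the data form: for data sets `D₁`, `D₂` on the same open
  `U ⊆ E3` whose components `hFun`, `kFun` agree on an open `W` with `U ∖ (V ∪ W)` null, and a
  third pair of component functions `h'`, `k'` agreeing with those of `D₁` on the open `V`, the
  distance `dataWeightedSobolevEDist s δ D₁ D₂` is at most
  `‖h' − hFun D₂‖_{H^s_δ(V)} + ‖k' − kFun D₂‖_{H^{s-1}_{δ+1}(V)}`;
* `dataWeightedSobolevEDist_slice_le_collar` — the instance used by the stub: on the Kerr–Schild
  slice `Kerr.slice a M = {r > M}` (`M > 0`), two data sets agreeing beyond an exactness radius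
  `Rₑ ≤ 4M` are, in `H^s_δ × H^{s-1}_{δ+1}` of the SLICE, no further apart than the collar
  (`{M < r < 4M}`) seminorms of clause (i)/(iii) of `IsSoftKerrShieldedC2`.

References: R. Bartnik, CPAM 39 (1986), (1.2); Y. Choquet-Bruhat, D. Christodoulou, Acta Math. 146
(1981), §2 (the `H_{s,δ}` seminorms are integrals over the domain, hence local and monotone in it).
-/

set_option linter.dupNamespace false

noncomputable section

open MeasureTheory Set Filter
open scoped ENNReal Topology ContDiff Manifold

namespace Summit.FinalStateConjecture.FinalStateConjecture.Theorems.CaptureSufficesC2.Sketch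

namespace SoftShieldedScri

open Literature.Geometry.Lorentzian

section Seminorm

variable {F G : Type*} [NormedAddCommGroup F] [NormedSpace ℝ F] [NormedAddCommGroup G]
  [NormedSpace ℝ G]

/-- **Locality of the global iterated derivative, vanishing form**: if `f` vanishes on the open
set `W`, then all its iterated Fréchet derivatives vanish on `W` (`f` agrees with `0` near each
point of `W`; `Filter.EventuallyEq.iteratedFDeriv`). [folklore] -/
theorem iteratedFDeriv_eq_zero_of_eqOn_zero {f : F → G} {W : Set F} (hW : IsOpen W)
    (hf : ∀ x ∈ W, f x = 0) (m : ℕ) {x : F} (hx : x ∈ W) : iteratedFDeriv ℝ m f x = 0 := by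
  have h : f =ᶠ[𝓝 x] (0 : F → G) := by
    filter_upwards [hW.mem_nhds hx] with y hy using hf y hy
  rw [(h.iteratedFDeriv ℝ m).eq_of_nhds, iteratedFDeriv_zero]
  rfl

/-- **Locality of the global iterated derivative**: two functions agreeing on an open set have
the same iterated Fréchet derivatives there (`Filter.EventuallyEq.iteratedFDeriv`). [folklore] -/
theorem iteratedFDeriv_congr_of_eqOn {f g : F → G} {V : Set F} (hV : IsOpen V)
    (hfg : EqOn f g V) (m : ℕ) {x : F} (hx : x ∈ V) :
    iteratedFDeriv ℝ m f x = iteratedFDeriv ℝ m g x := by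
  have h : f =ᶠ[𝓝 x] g := by
    filter_upwards [hV.mem_nhds hx] with y hy using hfg hy
  exact (h.iteratedFDeriv ℝ m).eq_of_nhds

end Seminorm

section Integral

variable {F : Type*} [MeasureSpace F]

/-- **Localisation of a set integral**: if the integrand `φ` vanishes on the measurable set `W`
and `U ∖ (V ∪ W)` is null, then `∫⁻_U φ ≤ ∫⁻_V φ` (cover `U ⊆ V ∪ W ∪ (U ∖ (V ∪ W))` and use
subadditivity of the set integral in the domain). [folklore] -/
theorem setLIntegral_le_of_eqOn_zero {φ : F → ℝ≥0∞} {U V W : Set F} (hWm : MeasurableSet W)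
    (hφ : ∀ x ∈ W, φ x = 0) (hnull : volume (U \ (V ∪ W)) = 0) :
    ∫⁻ x in U, φ x ≤ ∫⁻ x in V, φ x := by
  have hsub : U ⊆ V ∪ (W ∪ (U \ (V ∪ W))) := by
    intro x hx
    by_cases hV : x ∈ V
    · exact Or.inl hV
    · by_cases hW : x ∈ W
      · exact Or.inr (Or.inl hW)
      · exact Or.inr (Or.inr ⟨hx, fun h ↦ h.elim hV hW⟩)
  have hW0 : ∫⁻ x in W, φ x = 0 := by
    have hae : ∀ᵐ x ∂(volume.restrict W), φ x = (fun _ ↦ (0 : ℝ≥0∞)) x :=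
      (ae_restrict_iff' hWm).2 (Eventually.of_forall hφ)
    rw [lintegral_congr_ae hae, lintegral_zero]
  have hN0 : ∫⁻ x in U \ (V ∪ W), φ x = 0 := setLIntegral_measure_zero _ _ hnull
  calc ∫⁻ x in U, φ x ≤ ∫⁻ x in V ∪ (W ∪ (U \ (V ∪ W))), φ x := lintegral_mono_set hsub
    _ ≤ (∫⁻ x in V, φ x) + ∫⁻ x in W ∪ (U \ (V ∪ W)), φ x := lintegral_union_le _ _ _
    _ ≤ (∫⁻ x in V, φ x) + ((∫⁻ x in W, φ x) + ∫⁻ x in U \ (V ∪ W), φ x) :=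
        add_le_add le_rfl (lintegral_union_le _ _ _)
    _ = ∫⁻ x in V, φ x := by rw [hW0, hN0, add_zero, add_zero]

end Integral

section SeminormLocal

variable {F G : Type*} [NormedAddCommGroup F] [NormedSpace ℝ F] [NormedAddCommGroup G]
  [NormedSpace ℝ G] [MeasureSpace F]

/-- **Localisation of the weighted Sobolev seminorm (inequality).** If `f` vanishes on an open
measurable set `W` and `U ∖ (V ∪ W)` is Lebesgue-null, then `‖f‖_{H^s_δ(U)} ≤ ‖f‖_{H^s_δ(V)}`:
each integrand `(1 + ‖x‖)^{2(δ+m)} ‖D^m f(x)‖²` vanishes on `W` (locality of `iteratedFDeriv`).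
Bartnik 1986, (1.2). [cite: Bartnik1986, (1.2)] -/
theorem weightedSobolevSeminorm_le_of_eqOn_zero {f : F → G} {U V W : Set F} (hW : IsOpen W)
    (hWm : MeasurableSet W) (hf : ∀ x ∈ W, f x = 0) (hnull : volume (U \ (V ∪ W)) = 0)
    (s : ℕ) (δ : ℝ) :
    weightedSobolevSeminorm U s δ f ≤ weightedSobolevSeminorm V s δ f := by
  unfold weightedSobolevSeminorm
  refine ENNReal.rpow_le_rpow (Finset.sum_le_sum fun m _ ↦ ?_) (by norm_num)
  refine setLIntegral_le_of_eqOn_zero hWm (fun x hx ↦ ?_) hnull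
  rw [iteratedFDeriv_eq_zero_of_eqOn_zero hW hf m hx, norm_zero]
  simp

/-- **Localisation of the weighted Sobolev seminorm (equality).** If moreover `V ⊆ U`, then
`‖f‖_{H^s_δ(U)} = ‖f‖_{H^s_δ(V)}` (the reverse inequality is monotonicity in the domain,
`weightedSobolevSeminorm_mono`). Bartnik 1986, (1.2). [cite: Bartnik1986, (1.2)] -/
theorem weightedSobolevSeminorm_eq_of_eqOn_zero {f : F → G} {U V W : Set F} (hVU : V ⊆ U)
    (hW : IsOpen W) (hWm : MeasurableSet W) (hf : ∀ x ∈ W, f x = 0)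
    (hnull : volume (U \ (V ∪ W)) = 0) (s : ℕ) (δ : ℝ) :
    weightedSobolevSeminorm U s δ f = weightedSobolevSeminorm V s δ f :=
  le_antisymm (weightedSobolevSeminorm_le_of_eqOn_zero hW hWm hf hnull s δ)
    (weightedSobolevSeminorm_mono hVU s δ f)

/-- **The weighted Sobolev seminorm over an open set only depends on the restriction of the
function to that set** (locality of `iteratedFDeriv` on open sets). Bartnik 1986, (1.2).
[cite: Bartnik1986, (1.2)] -/
theorem weightedSobolevSeminorm_congr {f g : F → G} {V : Set F} (hV : IsOpen V)
    (hVm : MeasurableSet V) (hfg : EqOn f g V) (s : ℕ) (δ : ℝ) :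
    weightedSobolevSeminorm V s δ f = weightedSobolevSeminorm V s δ g := by
  unfold weightedSobolevSeminorm
  congr 1
  refine Finset.sum_congr rfl fun m _ ↦ lintegral_congr_ae ((ae_restrict_iff' hVm).2
    (Eventually.of_forall fun x hx ↦ ?_))
  simp only [iteratedFDeriv_congr_of_eqOn hV hfg m hx]

end SeminormLocal

/-! ### The data form -/

section Data

variable {U : TopologicalSpace.Opens E3}

/-- **Localisation of the weighted Sobolev distance of data sets to a collar.**  Let `D₁`, `D₂` be
data sets on the same open `U ⊆ E3` whose components `hFun`, `kFun` AGREE on an open set `W`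
(e.g. the far region `{r > 4M}` where the leaf datum IS the Kerr–Schild leaf datum), let `V` be
an open set (the collar) with `U ∖ (V ∪ W)` Lebesgue-null, and let `h'`, `k'` be component
functions agreeing with `hFun D₁`, `kFun D₁` on `V` (e.g. those of the pulled-back shield datum
`φ^* D`).  Then `dist_{H^s_δ × H^{s-1}_{δ+1}(U)}(D₁, D₂) ≤ ‖h' − hFun D₂‖_{H^s_δ(V)} +
‖k' − kFun D₂‖_{H^{s-1}_{δ+1}(V)}` — verbatim the two collar summands of clauses (i)/(iii) of the
soft shielding predicate.  Bartnik 1986, (1.2); Christodoulou–Klainerman 1993, (1.0.9).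
[cite: Bartnik1986, (1.2)] -/
theorem dataWeightedSobolevEDist_le_of_eqOn (D₁ D₂ : InitialDataSet 𝓘(ℝ, E3) U) {V W : Set E3}
    (hV : IsOpen V) (hW : IsOpen W)
    (hh : ∀ y ∈ W, D₁.hFun y = D₂.hFun y) (hk : ∀ y ∈ W, D₁.kFun y = D₂.kFun y)
    (hnull : volume ((U : Set E3) \ (V ∪ W)) = 0)
    {h' k' : E3 → E3 →L[ℝ] E3 →L[ℝ] ℝ} (hh' : EqOn h' D₁.hFun V) (hk' : EqOn k' D₁.kFun V)
    (s : ℕ) (δ : ℝ) :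
    InitialDataSet.dataWeightedSobolevEDist s δ D₁ D₂ ≤
      weightedSobolevSeminorm V s δ (h' - D₂.hFun) +
        weightedSobolevSeminorm V (s - 1) (δ + 1) (k' - D₂.kFun) := by
  have hWm : MeasurableSet W := hW.measurableSet
  have hVm : MeasurableSet V := hV.measurableSet
  unfold InitialDataSet.dataWeightedSobolevEDist
  have h₁ : weightedSobolevSeminorm (U : Set E3) s δ (D₁.hFun - D₂.hFun) ≤
      weightedSobolevSeminorm V s δ (h' - D₂.hFun) := by
    refine (weightedSobolevSeminorm_le_of_eqOn_zero hW hWm (fun y hy ↦ ?_) hnull s δ).trans_eq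
      (weightedSobolevSeminorm_congr hV hVm (fun y hy ↦ ?_) s δ)
    · rw [Pi.sub_apply, hh y hy]; exact sub_self (D₂.hFun y)
    · simp only [Pi.sub_apply, hh' hy]
  have h₂ : weightedSobolevSeminorm (U : Set E3) (s - 1) (δ + 1) (D₁.kFun - D₂.kFun) ≤
      weightedSobolevSeminorm V (s - 1) (δ + 1) (k' - D₂.kFun) := by
    refine (weightedSobolevSeminorm_le_of_eqOn_zero hW hWm (fun y hy ↦ ?_) hnull _ _).trans_eq
      (weightedSobolevSeminorm_congr hV hVm (fun y hy ↦ ?_) _ _)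
    · rw [Pi.sub_apply, hk y hy]; exact sub_self (D₂.kFun y)
    · simp only [Pi.sub_apply, hk' hy]
  exact add_le_add h₁ h₂

end Data

/-! ### The instance on the Kerr–Schild slice -/

section KerrSlice

/-- **The level sets of the Kerr–Schild radius are Lebesgue-null.**  For `R > 0` the set
`{y : E3 | r(a, (0, y)) = R}` lies on the confocal ellipsoid `(y₀² + y₁²)/(R² + a²) + y₂²/R² = 1`
(the defining quartic `r⁴ − (‖y‖² − a²) r² − a² y₂² = 0`, `Kerr.radius_quartic`), which is the
image of the unit sphere under the linear map `diag(√(R² + a²), √(R² + a²), R)`; linear images of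
the null sphere are null (`addHaar_image_linearMap`, `addHaar_sphere`).  Visser arXiv:0706.0622,
(33)–(35). [cite: arXiv07060622, (35)] -/
theorem volume_setOf_radius_eq (a : ℝ) {R : ℝ} (hR : 0 < R) :
    volume {y : E3 | Kerr.radius a (E4.ofTimeSpace 0 y) = R} = 0 := by
  set c : ℝ := Real.sqrt (R ^ 2 + a ^ 2) with hc_def
  have hc : 0 < c := Real.sqrt_pos.2 (by positivity)
  have hc2 : c ^ 2 = R ^ 2 + a ^ 2 := Real.sq_sqrt (by positivity)
  have h1 : R ^ 2 + a ^ 2 ≠ 0 := by positivity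
  have h2 : R ^ 2 ≠ 0 := by positivity
  -- the linear map `diag(c, c, R)`
  let d : Fin 3 → ℝ := ![c, c, R]
  let L : E3 →ₗ[ℝ] E3 :=
    { toFun := fun y ↦ WithLp.toLp 2 (fun i ↦ d i * y i)
      map_add' := fun y y' ↦ by ext i; simp [mul_add]
      map_smul' := fun s y ↦ by
        ext i; simp only [PiLp.smul_apply, smul_eq_mul, RingHom.id_apply]; ring }
  have hsub : {y : E3 | Kerr.radius a (E4.ofTimeSpace 0 y) = R} ⊆
      L '' Metric.sphere (0 : E3) 1 := by
    intro y hy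
    have hq := Kerr.radius_quartic a (E4.ofTimeSpace 0 y)
    rw [show Kerr.radius a (E4.ofTimeSpace 0 y) = R from hy, E4.spatialNorm_ofTimeSpace,
      show E4.ofTimeSpace 0 y 3 = y 2 from E4.ofTimeSpace_apply_succ 0 y 2] at hq
    have hn : ‖y‖ ^ 2 = y 0 ^ 2 + y 1 ^ 2 + y 2 ^ 2 := by
      rw [EuclideanSpace.real_norm_sq_eq, Fin.sum_univ_three]
    refine ⟨WithLp.toLp 2 ![y 0 / c, y 1 / c, y 2 / R], ?_, ?_⟩
    · rw [mem_sphere_zero_iff_norm]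
      have hsq : ‖(WithLp.toLp 2 ![y 0 / c, y 1 / c, y 2 / R] : E3)‖ ^ 2 = 1 := by
        rw [EuclideanSpace.real_norm_sq_eq, Fin.sum_univ_three]
        simp only [Matrix.cons_val_zero, Matrix.cons_val_one, Matrix.cons_val]
        rw [div_pow, div_pow, div_pow, hc2, ← add_div, div_add_div _ _ h1 h2,
          div_eq_one_iff_eq (mul_ne_zero h1 h2)]
        linear_combination -hq - R ^ 2 * hn
      have h0 : 0 ≤ ‖(WithLp.toLp 2 ![y 0 / c, y 1 / c, y 2 / R] : E3)‖ := norm_nonneg _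
      nlinarith [hsq, h0]
    · ext i
      fin_cases i
      · simp [L, d]; field_simp
      · simp [L, d]; field_simp
      · simp [L, d]; field_simp
  refine measure_mono_null hsub ?_
  rw [Measure.addHaar_image_linearMap, Measure.addHaar_sphere, mul_zero]

/-- **Localisation on the Kerr–Schild slice (the instance consumed by `stub_softShieldedScri`).**
On `Kerr.slice a M = {y | max M 0 < r(0, y)}` with `M > 0`, let `D₁` (the leaf datum) and `D₂`
(`Kerr.data M a M`) have components `hFun`, `kFun` agreeing on the open far region `{Rₑ < r}` for an
exactness radius `Rₑ ≤ 4M`, and let `h'`, `k'` (the components of the pulled-back shield datum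
`φ^* D`) agree with those of `D₁` on the open collar `{M < r < 4M}`.  Then
`dist_{H^s_δ × H^{s-1}_{δ+1}(slice)}(D₁, D₂)` is at most the sum of the two COLLAR seminorms of
`h' − hFun D₂`, `k' − kFun D₂` — verbatim the left-hand sides of clauses (i) (`< ε`) and (iii)
(`< ⊤`) of `IsSoftKerrShieldedC2`: the part of the slice outside collar and far region is the
sphere `{r = 4M}` (or empty), a null set (`volume_setOf_radius_eq`).  Bartnik 1986, (1.2);
Dafermos–Rodnianski arXiv:0811.0354, §5.1 (the slice). [cite: Bartnik1986, (1.2)] -/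
theorem dataWeightedSobolevEDist_slice_le_collar {M a Rₑ : ℝ} (hM : 0 < M) (hRₑ : Rₑ ≤ 4 * M)
    (D₁ D₂ : InitialDataSet 𝓘(ℝ, E3) (Kerr.slice a M))
    (hh : ∀ y : E3, Rₑ < Kerr.radius a (E4.ofTimeSpace 0 y) → D₁.hFun y = D₂.hFun y)
    (hk : ∀ y : E3, Rₑ < Kerr.radius a (E4.ofTimeSpace 0 y) → D₁.kFun y = D₂.kFun y)
    {h' k' : E3 → E3 →L[ℝ] E3 →L[ℝ] ℝ}
    (hh' : ∀ y : E3, M < Kerr.radius a (E4.ofTimeSpace 0 y) →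
      Kerr.radius a (E4.ofTimeSpace 0 y) < 4 * M → h' y = D₁.hFun y)
    (hk' : ∀ y : E3, M < Kerr.radius a (E4.ofTimeSpace 0 y) →
      Kerr.radius a (E4.ofTimeSpace 0 y) < 4 * M → k' y = D₁.kFun y)
    (s : ℕ) (δ : ℝ) :
    InitialDataSet.dataWeightedSobolevEDist s δ D₁ D₂ ≤
      weightedSobolevSeminorm
          {y : E3 | M < Kerr.radius a (E4.ofTimeSpace 0 y) ∧
            Kerr.radius a (E4.ofTimeSpace 0 y) < 4 * M} s δ (h' - D₂.hFun) +
        weightedSobolevSeminorm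
          {y : E3 | M < Kerr.radius a (E4.ofTimeSpace 0 y) ∧
            Kerr.radius a (E4.ofTimeSpace 0 y) < 4 * M} (s - 1) (δ + 1) (k' - D₂.kFun) := by
  have hcont : Continuous fun y : E3 ↦ Kerr.radius a (E4.ofTimeSpace 0 y) :=
    (Kerr.continuous_radius a).comp (E4.continuous_ofTimeSpace 0)
  set V : Set E3 := {y : E3 | M < Kerr.radius a (E4.ofTimeSpace 0 y) ∧
    Kerr.radius a (E4.ofTimeSpace 0 y) < 4 * M} with hV
  set W : Set E3 := {y : E3 | Rₑ < Kerr.radius a (E4.ofTimeSpace 0 y)} with hW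
  have hVo : IsOpen V := (isOpen_lt continuous_const hcont).inter (isOpen_lt hcont continuous_const)
  have hWo : IsOpen W := isOpen_lt continuous_const hcont
  -- the uncovered part of the slice is contained in the null sphere `{r = 4M}`
  have hnull : volume ((Kerr.slice a M : Set E3) \ (V ∪ W)) = 0 := by
    refine measure_mono_null (fun y hy ↦ ?_) (volume_setOf_radius_eq a (R := 4 * M) (by linarith))
    obtain ⟨hyU, hyVW⟩ := hy
    have hyM : M < Kerr.radius a (E4.ofTimeSpace 0 y) :=
      (le_max_left M 0).trans_lt (Kerr.mem_slice.1 hyU)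
    have h4 : ¬ Kerr.radius a (E4.ofTimeSpace 0 y) < 4 * M := fun h ↦ hyVW (Or.inl ⟨hyM, h⟩)
    have hR : ¬ Rₑ < Kerr.radius a (E4.ofTimeSpace 0 y) := fun h ↦ hyVW (Or.inr h)
    show Kerr.radius a (E4.ofTimeSpace 0 y) = 4 * M
    push Not at h4 hR
    linarith
  exact dataWeightedSobolevEDist_le_of_eqOn D₁ D₂ hVo hWo (fun y hy ↦ hh y hy) (fun y hy ↦ hk y hy)
    hnull (fun y hy ↦ hh' y hy.1 hy.2) (fun y hy ↦ hk' y hy.1 hy.2) s δ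

/-- **Registered sub-goal `stub_softShieldedScri_localisation` of stub `stub_softShieldedScri`**
(line `Sketch`, crux stmt-FinalStateConjecture-14986): the slice distance of the leaf datum to
`Kerr.data` localises to the collar — `dataWeightedSobolevEDist_slice_le_collar` in the registered
binder form. [cite: Bartnik1986, (1.2)] -/
theorem stub_softShieldedScri_localisation : ∀ (M a Rₑ : ℝ), 0 < M → Rₑ ≤ 4 * M → ∀ (D₁ D₂ : InitialDataSet 𝓘(ℝ, E3) (Kerr.slice a M)), (∀ y : E3, Rₑ < Kerr.radius a (E4.ofTimeSpace 0 y) → D₁.hFun y = D₂.hFun y) → (∀ y : E3, Rₑ < Kerr.radius a (E4.ofTimeSpace 0 y) → D₁.kFun y = D₂.kFun y) → ∀ (h' k' : E3 → E3 →L[ℝ] E3 →L[ℝ] ℝ), (∀ y : E3, M < Kerr.radius a (E4.ofTimeSpace 0 y) → Kerr.radius a (E4.ofTimeSpace 0 y) < 4 * M → h' y = D₁.hFun y) → (∀ y : E3, M < Kerr.radius a (E4.ofTimeSpace 0 y) → Kerr.radius a (E4.ofTimeSpace 0 y) < 4 * M → k' y = D₁.kFun y) → ∀ (s : ℕ) (δ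 : ℝ), InitialDataSet.dataWeightedSobolevEDist s δ D₁ D₂ ≤ weightedSobolevSeminorm {y : E3 | M < Kerr.radius a (E4.ofTimeSpace 0 y) ∧ Kerr.radius a (E4.ofTimeSpace 0 y) < 4 * M} s δ (h' - D₂.hFun) + weightedSobolevSeminorm {y : E3 | M < Kerr.radius a (E4.ofTimeSpace 0 y) ∧ Kerr.radius a (E4.ofTimeSpace 0 y) < 4 * M} (s - 1) (δ + 1) (k' - D₂.kFun) :=
  fun _ _ _ hM hRₑ D₁ D₂ hh hk _ _ hh' hk' s δ ↦
    dataWeightedSobolevEDist_slice_le_collar hM hRₑ D₁ D₂ hh hk hh' hk' s δ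

end KerrSlice

end SoftShieldedScri

end Summit.FinalStateConjecture.FinalStateConjecture.Theorems.CaptureSufficesC2.Sketch

end
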